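import Mathlib.LinearAlgebra.BilinearForm.Basic
import Mathlib.LinearAlgebra.Matrix.BilinearForm
import Mathlib.LinearAlgebra.Matrix.NonsingularInverse
import Mathlib.LinearAlgebra.Matrix.DotProduct
import Mathlib.Algebra.QuadraticDiscriminant
import Mathlib.Algebra.Order.BigOperators.Ring.Finset
import Mathlib.Data.Real.Basic
import HarnessLib

/-!
# Certifying `β(z,z) ≥ Ψ(z)ᵀ S Ψ(z)` from an APPROXIMATE Gram matrix
# (Gram lemma, second-order Gram identity, perturbation lemma, diagonal scaling)

HONEST FRAMING (cell ns-blowup GROUP B / zone Z3, case Z3-SR-SPEC, implementation-1 certificate S1; abstract bilinear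
algebra behind a 1-D MODEL spectral certificate; not Euler/NS). Everything proved, no definitions, no named facts. `E` is a real
vector space, `β` a symmetric positive-semidefinite bilinear form on `E` (`β x y = β y x`, `0 ≤ β x x`; no completeness, no
definiteness), `u : ι → E` a finite family with functionals `ψ_i := β(u_i, ·)` (in applications `u_i = 𝔅⁻¹ψ_i` comes from
a Lax–Milgram solution operator; here `u` is data), `S` any real `ι × ι` matrix, `G_ij := β(u_i, u_j)` the exact (unknown)
Gram matrix; for the values `p_i := ψ_i(z)` the quantity to be controlled is the finite-rank form `pᵀ S p`.
* Cauchy–Schwarz for `β` (`bilinForm_apply_sq_le_mul`); `β(Σ xᵢuᵢ, z) = x ⬝ p`, `β(Σ xᵢuᵢ, Σ xⱼuⱼ) = xᵀ G x`.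
* **Gram lemma** (`dotProduct_mulVec_le_form_of_gram_certificate`): if `(Gx)ᵀ S (Gx) < xᵀ G x` for every `x ≠ 0`
  (for symmetric `S`, `G`: `F(G) := G − GSG ≻ 0`), then `Ψ(z)ᵀ S Ψ(z) ≤ β(z, z)` for EVERY `z ∈ E`. Proof: `x ↦ Gx` is
  injective hence surjective (`Matrix.mulVec_injective_iff_isUnit`), so `Ψ(z) = Gy`; with `v := Σ yᵢuᵢ`,
  `β(v,v) = β(v,z) = yᵀGy`, Cauchy–Schwarz gives `yᵀGy ≤ β(z,z)`, and the hypothesis gives `(Gy)ᵀS(Gy) ≤ yᵀGy`.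
  No projection, no invertibility of `S`, no completeness of `E`.
* **Second-order Gram identity** (`form_sub_apprGram_eq`, `gram_eq_apprGram_add_errGram`): for approximations `ũ_i`,
  errors `ε_i := u_i − ũ_i` and residual functionals `r_i := ψ_i − β(ũ_i, ·) = β(ε_i, ·)`, the COMPUTABLE matrix
  `Ĝ_ij := ψ_j(ũ_i) + r_i(ũ_j)` satisfies `G − Ĝ = ℰ := (β(ε_i, ε_j))_ij` EXACTLY — a Gram matrix, hence
  `0 ≤ xᵀℰx ≤ (Σ_i β(ε_i, ε_i))·|x|²` (`gram_dotProduct_mulVec_nonneg`, `gram_dotProduct_mulVec_le_trace_mul`).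
* **Perturbation lemma** (`apprGram_perturbation`): `Ĝ, S, ℰ` symmetric, `0 ≤ xᵀℰx ≤ d|x|²`, `vᵀSv ≤ s|v|²`, `0 ≤ s`,
  `0 ≤ d`, `sd < 1` ⇒ `xᵀF(Ĝ + ℰ)x ≥ xᵀF(Ĝ)x − d′|SĜx|²`, `d′ = d/(1 − sd)` — square-root-free (`|ℰx|² ≤ d·xᵀℰx` by
  Cauchy–Schwarz for the `ℰ`-form; cross term `2xᵀℰb ≤ η xᵀℰx + η⁻¹ bᵀℰb` with `η = 1 − sd`).
* **Assembly** (`dotProduct_mulVec_le_form_of_apprGram_certificate`): `Σ_i β(ε_i, ε_i) ≤ d`, `vᵀSv ≤ s|v|²`, `sd < 1`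
  and `0 < xᵀ(Ĝ − ĜSĜ)x − d′|SĜx|²` for all `x ≠ 0` ⇒ `Ψ(z)ᵀ S Ψ(z) ≤ β(z, z)` on `E`.
* **Diagonal scaling** (`pos_of_pos_diagScaled`, `quadForm_pos_of_lowerBound_pos`): positivity may be certified after
  the congruence `x = Dy` (`D` diagonal, no zero entries), and `λ|y|² ≤ q(y)`, `λ > 0` gives `q(y) > 0` for `y ≠ 0` —
  the shape of a ball-arithmetic eigenvector-congruence + Gershgorin verdict (those layers are
  `Literature.Analysis.ValidatedNumerics.IntervalGershgorin.psdCheck`, `….ValidatedNumerics.PSDCert`,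
  `Literature.Analysis.Matrix.EigenvalueCountFromCongruence` — not restated here).

Source and use. Elementary bilinear algebra ([folklore]): the Gram lemma is the finite-rank Schur-complement criterion
written without inverses; replacing the exact Gram matrix of weak solutions by computable pairings with their residuals
is Goerisch's device in the Lehmann–Goerisch method (`Literature.Analysis.OperatorTheory.LehmannGoerisch`,
[cite: ZimmermannMertins1995, §1]) pushed to second order; the projection form of the Gram step for inner products is
`Literature.Analysis.OperatorTheory.GramPencilBound` (`exists_gram_mulVec_eq_inner`). These are the paper items
"(P3′) Gram lemma + second-order Gram identity + perturbation lemma" of `RUNBOOK-SPEC-impl1.md` §6.5 (b)–(e) behind the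
interval certificate S1 of the cell `ns-blowup`, case Z3-SR-SPEC (Lean row
`Summits/NavierStokesRegularity/OSWSelfSimilar/CertificateViscousSheetRSpectrum.lean`): there `E` is the odd energy
class, `β` the local symmetric form `β_used`, `Ψ` the head/tail functionals, `S` the finite-rank coupling matrix,
`d = Σ ρ_i²` the residual budget, and the certified number is `λ_min(D(F(Ĝ) − d′ĜSᵀSĜ)D) > 0`. WHAT THIS FILE IS NOT:
it says nothing about that model, about interval arithmetic, or about Navier–Stokes; it is the abstract algebra making
"certified matrix inequality ⇒ form inequality on the infinite-dimensional space" kernel-checked.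
-/

open Matrix Finset

namespace Summit.NavierStokesRegularity.OSWSelfSimilar
namespace ApproximateGramCertificate

section Form
variable {E : Type*} [AddCommGroup E] [Module ℝ E]
variable {ι : Type*} [Fintype ι]

/-- **Cauchy–Schwarz** for a symmetric positive-semidefinite real bilinear form:
`β(a,b)² ≤ β(a,a) β(b,b)` (no definiteness needed). [folklore] -/
theorem bilinForm_apply_sq_le_mul (β : LinearMap.BilinForm ℝ E)
    (hsymm : ∀ x y, β x y = β y x) (hpos : ∀ x, 0 ≤ β x x) (a b : E) :
    (β a b) ^ 2 ≤ β a a * β b b := by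
  have h : ∀ t : ℝ, 0 ≤ β a a * (t * t) + (2 * β a b) * t + β b b := by
    intro t
    have hexp : β (t • a + b) (t • a + b) = β a a * (t * t) + (2 * β a b) * t + β b b := by
      simp only [map_add, map_smul, LinearMap.add_apply, LinearMap.smul_apply, smul_eq_mul,
        hsymm b a]
      ring
    rw [← hexp]
    exact hpos _
  have hd := discrim_le_zero h
  rw [discrim] at hd
  nlinarith [hd]

/-- `β(Σ xᵢ uᵢ, z) = x ⬝ᵥ (β(uᵢ, z))ᵢ`. [folklore] -/
theorem bilinForm_sum_smul_left_eq_dotProduct (β : LinearMap.BilinForm ℝ E) (u : ι → E)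
    (x : ι → ℝ) (z : E) :
    β (∑ i, x i • u i) z = x ⬝ᵥ fun i => β (u i) z := by
  simp only [map_sum, map_smul, LinearMap.sum_apply, LinearMap.smul_apply, smul_eq_mul,
    dotProduct]

/-- `β(Σ xᵢ uᵢ, Σ xⱼ uⱼ) = xᵀ G x` for any matrix `G` with entries `G i j = β(uᵢ, uⱼ)`. [folklore] -/
theorem bilinForm_sum_smul_sum_smul_eq_dotProduct_mulVec (β : LinearMap.BilinForm ℝ E) (u : ι → E)
    (G : Matrix ι ι ℝ) (hG : ∀ i j, G i j = β (u i) (u j)) (x : ι → ℝ) :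
    β (∑ i, x i • u i) (∑ j, x j • u j) = x ⬝ᵥ (G *ᵥ x) := by
  rw [bilinForm_sum_smul_left_eq_dotProduct]
  unfold dotProduct
  refine Finset.sum_congr rfl fun i _ => ?_
  congr 1
  simp only [mulVec, dotProduct, map_sum, map_smul, smul_eq_mul, hG]
  refine Finset.sum_congr rfl fun j _ => ?_
  ring

/-- The Gram form of any finite family is non-negative: `0 ≤ xᵀ ℰ x` for `ℰ i j = β(eᵢ, eⱼ)`.
[folklore] -/
theorem gram_dotProduct_mulVec_nonneg (β : LinearMap.BilinForm ℝ E) (hpos : ∀ x, 0 ≤ β x x)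
    (e : ι → E) (Er : Matrix ι ι ℝ) (hEr : ∀ i j, Er i j = β (e i) (e j)) (x : ι → ℝ) :
    0 ≤ x ⬝ᵥ (Er *ᵥ x) := by
  rw [← bilinForm_sum_smul_sum_smul_eq_dotProduct_mulVec β e Er hEr x]
  exact hpos _

/-- **Trace bound for a Gram form**: `xᵀ ℰ x ≤ (Σᵢ β(eᵢ, eᵢ)) · |x|²` for `ℰ i j = β(eᵢ, eⱼ)`,
`β` symmetric positive semidefinite (i.e. `ℰ ≼ (tr ℰ) I`). [folklore] -/
theorem gram_dotProduct_mulVec_le_trace_mul (β : LinearMap.BilinForm ℝ E)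
    (hsymm : ∀ x y, β x y = β y x) (hpos : ∀ x, 0 ≤ β x x)
    (e : ι → E) (Er : Matrix ι ι ℝ) (hEr : ∀ i j, Er i j = β (e i) (e j)) (x : ι → ℝ) :
    x ⬝ᵥ (Er *ᵥ x) ≤ (∑ i, β (e i) (e i)) * (x ⬝ᵥ x) := by
  set w : E := ∑ i, x i • e i with hw
  have hform : x ⬝ᵥ (Er *ᵥ x) = β w w :=
    (bilinForm_sum_smul_sum_smul_eq_dotProduct_mulVec β e Er hEr x).symm
  have hlin : β w w = ∑ i, x i * β (e i) w := by
    rw [hw, bilinForm_sum_smul_left_eq_dotProduct]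
    rfl
  have hcs1 : (∑ i, x i * β (e i) w) ^ 2 ≤ (∑ i, x i ^ 2) * ∑ i, (β (e i) w) ^ 2 :=
    Finset.sum_mul_sq_le_sq_mul_sq _ _ _
  have hcs2 : ∑ i, (β (e i) w) ^ 2 ≤ (∑ i, β (e i) (e i)) * β w w := by
    rw [Finset.sum_mul]
    exact Finset.sum_le_sum fun i _ => bilinForm_apply_sq_le_mul β hsymm hpos (e i) w
  have hxx : x ⬝ᵥ x = ∑ i, x i ^ 2 := by simp only [dotProduct, sq]
  have htr : 0 ≤ ∑ i, β (e i) (e i) := Finset.sum_nonneg fun i _ => hpos (e i)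
  have hX : 0 ≤ ∑ i, x i ^ 2 := Finset.sum_nonneg fun i _ => sq_nonneg (x i)
  have hB : 0 ≤ β w w := hpos w
  rw [hform, hxx]
  have hkey : β w w * β w w ≤ ((∑ i, β (e i) (e i)) * ∑ i, x i ^ 2) * β w w := by
    have h1 : (β w w) ^ 2 ≤ (∑ i, x i ^ 2) * ((∑ i, β (e i) (e i)) * β w w) := by
      rw [hlin]
      exact hcs1.trans (mul_le_mul_of_nonneg_left (hlin ▸ hcs2) hX)
    nlinarith [h1]
  by_cases h0 : β w w = 0
  · rw [h0]; exact mul_nonneg htr hX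
  · exact le_of_mul_le_mul_right hkey (lt_of_le_of_ne hB (Ne.symm h0))

omit [Fintype ι] in
/-- **Second-order Gram identity (entrywise).** With `εᵢ := uᵢ − ũᵢ`, the computable entry
`Ĝ i j := ψⱼ(ũᵢ) + rᵢ(ũⱼ) = β(uⱼ, ũᵢ) + β(εᵢ, ũⱼ)` differs from the exact Gram entry
`β(uᵢ, uⱼ)` by exactly `β(εᵢ, εⱼ)`. [folklore] -/
theorem form_sub_apprGram_eq (β : LinearMap.BilinForm ℝ E) (hsymm : ∀ x y, β x y = β y x)
    (u ut : ι → E) (i j : ι) :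
    β (u i) (u j) - (β (u j) (ut i) + β (u i - ut i) (ut j)) = β (u i - ut i) (u j - ut j) := by
  simp only [map_sub, LinearMap.sub_apply]
  rw [hsymm (u j) (ut i)]
  ring

omit [Fintype ι] in
/-- **Second-order Gram identity (matrix form).** `G = Ĝ + ℰ` with `ℰ i j = β(εᵢ, εⱼ)`,
`εᵢ = uᵢ − ũᵢ`. [folklore] -/
theorem gram_eq_apprGram_add_errGram (β : LinearMap.BilinForm ℝ E) (hsymm : ∀ x y, β x y = β y x)
    (u ut : ι → E) (G Gh Er : Matrix ι ι ℝ) (hG : ∀ i j, G i j = β (u i) (u j))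
    (hGh : ∀ i j, Gh i j = β (u j) (ut i) + β (u i - ut i) (ut j))
    (hEr : ∀ i j, Er i j = β (u i - ut i) (u j - ut j)) :
    G = Gh + Er := by
  ext i j
  rw [Matrix.add_apply, hG, hGh, hEr, ← form_sub_apprGram_eq β hsymm u ut i j]
  ring

/-- **Gram lemma (certificate form).** Let `G i j = β(uᵢ, uⱼ)` and let `S` be any matrix. If
`(Gx)ᵀ S (Gx) < xᵀ G x` for every `x ≠ 0` (for symmetric `G`, `S` this says
`F(G) := G − G S G` is positive definite), then for every `z ∈ E` the finite-rank form of the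
values `pᵢ := β(uᵢ, z)` is dominated by the energy: `pᵀ S p ≤ β(z, z)`. [folklore] -/
theorem dotProduct_mulVec_le_form_of_gram_certificate (β : LinearMap.BilinForm ℝ E)
    (hsymm : ∀ x y, β x y = β y x) (hpos : ∀ x, 0 ≤ β x x) (u : ι → E)
    (G : Matrix ι ι ℝ) (hG : ∀ i j, G i j = β (u i) (u j)) (S : Matrix ι ι ℝ)
    (hcert : ∀ x : ι → ℝ, x ≠ 0 → (G *ᵥ x) ⬝ᵥ (S *ᵥ (G *ᵥ x)) < x ⬝ᵥ (G *ᵥ x)) (z : E) :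
    (fun i => β (u i) z) ⬝ᵥ (S *ᵥ fun i => β (u i) z) ≤ β z z := by
  classical
  set p : ι → ℝ := fun i => β (u i) z with hp
  have hinj : Function.Injective G.mulVec := by
    intro x y hxy
    by_contra hne
    have h := hcert (x - y) (sub_ne_zero.mpr hne)
    simp only [Matrix.mulVec_sub, hxy, sub_self, Matrix.mulVec_zero, dotProduct_zero] at h
    exact lt_irrefl _ h
  have hsurj : Function.Surjective G.mulVec :=
    Matrix.mulVec_surjective_iff_isUnit.mpr (Matrix.mulVec_injective_iff_isUnit.mp hinj)
  obtain ⟨y, hy⟩ := hsurj p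
  set v : E := ∑ i, y i • u i with hv
  have hvz : β v z = y ⬝ᵥ p := bilinForm_sum_smul_left_eq_dotProduct β u y z
  have hvv : β v v = y ⬝ᵥ p := by
    rw [hv, bilinForm_sum_smul_sum_smul_eq_dotProduct_mulVec β u G hG y]
    exact congrArg _ hy
  have hcs := bilinForm_apply_sq_le_mul β hsymm hpos v z
  rw [hvz, hvv] at hcs
  have hzz := hpos z
  have ht : y ⬝ᵥ p ≤ β z z := by
    rcases le_or_gt (y ⬝ᵥ p) 0 with h0 | h0
    · exact h0.trans hzz
    · nlinarith [hcs, h0]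
  have hS : p ⬝ᵥ (S *ᵥ p) ≤ y ⬝ᵥ p := by
    by_cases hy0 : y = 0
    · have hp0 : p = 0 := by rw [← hy, hy0, Matrix.mulVec_zero]
      rw [hp0, hy0, zero_dotProduct, zero_dotProduct]
    · have h := hcert y hy0
      rw [hy] at h
      exact h.le
  exact hS.trans ht

end Form

section Matrices
variable {ι : Type*} [Fintype ι]

/-- `vᵀ M w = wᵀ M v` for a symmetric real matrix. [folklore] -/
theorem dotProduct_mulVec_comm_of_transpose_eq (M : Matrix ι ι ℝ) (hM : Mᵀ = M) (v w : ι → ℝ) :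
    v ⬝ᵥ (M *ᵥ w) = w ⬝ᵥ (M *ᵥ v) := by
  rw [Matrix.dotProduct_mulVec, ← Matrix.mulVec_transpose, hM, dotProduct_comm]

/-- For a symmetric matrix `ℰ` with `0 ≤ xᵀℰx ≤ d |x|²` (`0 ≤ d`): `|ℰ x|² ≤ d · xᵀ ℰ x`
(i.e. `ℰ² ≼ d ℰ`), by Cauchy–Schwarz for the `ℰ`-form — no square roots, no spectral theorem.
[folklore] -/
theorem mulVec_dotProduct_self_le_of_form_le (Er : Matrix ι ι ℝ) (hEr : Erᵀ = Er) {d : ℝ}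
    (hd : 0 ≤ d) (hEpos : ∀ x, 0 ≤ x ⬝ᵥ (Er *ᵥ x))
    (hEd : ∀ x, x ⬝ᵥ (Er *ᵥ x) ≤ d * (x ⬝ᵥ x)) (x : ι → ℝ) :
    (Er *ᵥ x) ⬝ᵥ (Er *ᵥ x) ≤ d * (x ⬝ᵥ (Er *ᵥ x)) := by
  classical
  set a := Er *ᵥ x with ha
  have hcs := bilinForm_apply_sq_le_mul (Matrix.toBilin' Er)
    (fun v w => by
      rw [Matrix.toBilin'_apply', Matrix.toBilin'_apply']
      exact dotProduct_mulVec_comm_of_transpose_eq Er hEr v w)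
    (fun v => by rw [Matrix.toBilin'_apply']; exact hEpos v) x a
  rw [Matrix.toBilin'_apply', Matrix.toBilin'_apply', Matrix.toBilin'_apply'] at hcs
  have hxa : x ⬝ᵥ (Er *ᵥ a) = a ⬝ᵥ a := by
    rw [dotProduct_mulVec_comm_of_transpose_eq Er hEr x a]
  rw [hxa] at hcs
  have haa : 0 ≤ a ⬝ᵥ a := by
    unfold dotProduct; exact Finset.sum_nonneg fun i _ => mul_self_nonneg _
  have hX : 0 ≤ x ⬝ᵥ (Er *ᵥ x) := hEpos x
  have hEa : a ⬝ᵥ (Er *ᵥ a) ≤ d * (a ⬝ᵥ a) := hEd a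
  have hkey : (a ⬝ᵥ a) * (a ⬝ᵥ a) ≤ (d * (x ⬝ᵥ (Er *ᵥ x))) * (a ⬝ᵥ a) := by
    have h1 : (a ⬝ᵥ a) ^ 2 ≤ (x ⬝ᵥ (Er *ᵥ x)) * (d * (a ⬝ᵥ a)) :=
      hcs.trans (mul_le_mul_of_nonneg_left hEa hX)
    nlinarith [h1]
  by_cases h0 : a ⬝ᵥ a = 0
  · rw [h0]; exact mul_nonneg hd hX
  · exact le_of_mul_le_mul_right hkey (lt_of_le_of_ne haa (Ne.symm h0))

/-- The `η`-weighted cross-term bound for a symmetric positive-semidefinite form: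
`2 xᵀ ℰ b ≤ η xᵀ ℰ x + η⁻¹ bᵀ ℰ b` (`η > 0`), from `0 ≤ (ηx − b)ᵀ ℰ (ηx − b)`. [folklore] -/
theorem two_mul_dotProduct_mulVec_le (Er : Matrix ι ι ℝ) (hEr : Erᵀ = Er)
    (hEpos : ∀ x, 0 ≤ x ⬝ᵥ (Er *ᵥ x)) {η : ℝ} (hη : 0 < η) (x b : ι → ℝ) :
    2 * (x ⬝ᵥ (Er *ᵥ b)) ≤ η * (x ⬝ᵥ (Er *ᵥ x)) + (b ⬝ᵥ (Er *ᵥ b)) / η := by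
  have h0 := hEpos (η • x - b)
  have hexp : (η • x - b) ⬝ᵥ (Er *ᵥ (η • x - b))
      = η * η * (x ⬝ᵥ (Er *ᵥ x)) - 2 * η * (x ⬝ᵥ (Er *ᵥ b)) + b ⬝ᵥ (Er *ᵥ b) := by
    have hbx : b ⬝ᵥ (Er *ᵥ x) = x ⬝ᵥ (Er *ᵥ b) :=
      dotProduct_mulVec_comm_of_transpose_eq Er hEr b x
    rw [Matrix.mulVec_sub, Matrix.mulVec_smul, sub_dotProduct, dotProduct_sub, dotProduct_sub,
      smul_dotProduct, smul_dotProduct, dotProduct_smul, dotProduct_smul, hbx]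
    simp only [smul_eq_mul]
    ring
  rw [hexp] at h0
  have h1 : 2 * (x ⬝ᵥ (Er *ᵥ b)) * η ≤ (η * (x ⬝ᵥ (Er *ᵥ x)) + (b ⬝ᵥ (Er *ᵥ b)) / η) * η := by
    rw [add_mul, div_mul_cancel₀ _ hη.ne']
    nlinarith [h0]
  exact le_of_mul_le_mul_right h1 hη

/-- **Perturbation lemma.** For symmetric `Ĝ, S, ℰ` with `0 ≤ xᵀℰx ≤ d|x|²`,
`vᵀ S v ≤ s |v|²`, `0 ≤ s`, `0 ≤ d`, `s d < 1`, writing `F(M) x := xᵀ M x − (Mx)ᵀ S (Mx)`: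
`F(Ĝ + ℰ) x ≥ F(Ĝ) x − d/(1 − s d) · |S Ĝ x|²`. [folklore] -/
theorem apprGram_perturbation (Gh S Er : Matrix ι ι ℝ) (hS : Sᵀ = S) (hEr : Erᵀ = Er)
    {s d : ℝ} (hs : 0 ≤ s) (hd : 0 ≤ d) (hsd : s * d < 1)
    (hEpos : ∀ x, 0 ≤ x ⬝ᵥ (Er *ᵥ x)) (hEd : ∀ x, x ⬝ᵥ (Er *ᵥ x) ≤ d * (x ⬝ᵥ x))
    (hSle : ∀ v, v ⬝ᵥ (S *ᵥ v) ≤ s * (v ⬝ᵥ v)) (x : ι → ℝ) :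
    x ⬝ᵥ (Gh *ᵥ x) - (Gh *ᵥ x) ⬝ᵥ (S *ᵥ (Gh *ᵥ x))
        - d / (1 - s * d) * ((S *ᵥ (Gh *ᵥ x)) ⬝ᵥ (S *ᵥ (Gh *ᵥ x)))
      ≤ x ⬝ᵥ ((Gh + Er) *ᵥ x) - ((Gh + Er) *ᵥ x) ⬝ᵥ (S *ᵥ ((Gh + Er) *ᵥ x)) := by
  set g := Gh *ᵥ x with hg
  set a := Er *ᵥ x with ha
  set b := S *ᵥ g with hb
  set η : ℝ := 1 - s * d with hηdef
  have hη : 0 < η := by rw [hηdef]; linarith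
  have hsplit : (Gh + Er) *ᵥ x = g + a := Matrix.add_mulVec Gh Er x
  rw [hsplit]
  have hag : a ⬝ᵥ (S *ᵥ g) = g ⬝ᵥ (S *ᵥ a) := dotProduct_mulVec_comm_of_transpose_eq S hS a g
  have hRHS : x ⬝ᵥ (g + a) - (g + a) ⬝ᵥ (S *ᵥ (g + a))
      = (x ⬝ᵥ g - g ⬝ᵥ b) + (x ⬝ᵥ a - a ⬝ᵥ (S *ᵥ a) - 2 * (g ⬝ᵥ (S *ᵥ a))) := by
    rw [Matrix.mulVec_add, dotProduct_add, add_dotProduct, dotProduct_add, dotProduct_add, hag, hb]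
    ring
  rw [hRHS]
  have hcross : g ⬝ᵥ (S *ᵥ a) = x ⬝ᵥ (Er *ᵥ b) := by
    rw [← hag, ← hb, ha, dotProduct_comm, dotProduct_mulVec_comm_of_transpose_eq Er hEr b x]
  have hI1 : a ⬝ᵥ (S *ᵥ a) ≤ s * (a ⬝ᵥ a) := hSle a
  have hI2 : a ⬝ᵥ a ≤ d * (x ⬝ᵥ a) := by
    rw [ha]; exact mulVec_dotProduct_self_le_of_form_le Er hEr hd hEpos hEd x
  have hI3 : 2 * (x ⬝ᵥ (Er *ᵥ b)) ≤ η * (x ⬝ᵥ (Er *ᵥ x)) + (b ⬝ᵥ (Er *ᵥ b)) / η :=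
    two_mul_dotProduct_mulVec_le Er hEr hEpos hη x b
  have hI4 : b ⬝ᵥ (Er *ᵥ b) ≤ d * (b ⬝ᵥ b) := hEd b
  have hX : 0 ≤ x ⬝ᵥ a := by rw [ha]; exact hEpos x
  have hxa : x ⬝ᵥ (Er *ᵥ x) = x ⬝ᵥ a := by rw [ha]
  rw [hcross, hxa] at *
  have hI3' : 2 * (x ⬝ᵥ (Er *ᵥ b)) * η ≤ η * η * (x ⬝ᵥ a) + d * (b ⬝ᵥ b) := by
    have := mul_le_mul_of_nonneg_right hI3 hη.le
    rw [add_mul, div_mul_cancel₀ _ hη.ne'] at this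
    nlinarith [this, hI4]
  have key : 0 ≤ (x ⬝ᵥ a - a ⬝ᵥ (S *ᵥ a) - 2 * (x ⬝ᵥ (Er *ᵥ b))) * η + d * (b ⬝ᵥ b) := by
    have hsd' : a ⬝ᵥ (S *ᵥ a) ≤ s * d * (x ⬝ᵥ a) := by
      calc a ⬝ᵥ (S *ᵥ a) ≤ s * (a ⬝ᵥ a) := hI1
        _ ≤ s * (d * (x ⬝ᵥ a)) := mul_le_mul_of_nonneg_left hI2 hs
        _ = s * d * (x ⬝ᵥ a) := by ring
    have hηeq : η = 1 - s * d := hηdef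
    nlinarith [hsd', hI3', hη.le, hX, hηeq]
  have hfin : -(x ⬝ᵥ a - a ⬝ᵥ (S *ᵥ a) - 2 * (x ⬝ᵥ (Er *ᵥ b))) ≤ d * (b ⬝ᵥ b) / η := by
    rw [le_div_iff₀ hη]
    linarith
  have hdiv : d / η * (b ⬝ᵥ b) = d * (b ⬝ᵥ b) / η := by ring
  rw [hdiv]
  linarith

omit [Fintype ι] in
/-- **Diagonal scaling.** If a real function `q` on `ι → ℝ` is positive at every non-zero
vector of the form `D y` (`D` diagonal without zero entries), it is positive at every non-zero
vector. (Used with `q x = xᵀ M x`: certify `D M D ≻ 0` instead of `M ≻ 0`.) [folklore] -/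
theorem pos_of_pos_diagScaled {q : (ι → ℝ) → ℝ} (D : ι → ℝ) (hD : ∀ i, D i ≠ 0)
    (h : ∀ y : ι → ℝ, y ≠ 0 → 0 < q (fun i => D i * y i)) (x : ι → ℝ) (hx : x ≠ 0) :
    0 < q x := by
  have hxy : (fun i => D i * (x i / D i)) = x := by
    funext i
    rw [mul_div_cancel₀ _ (hD i)]
  have hy : (fun i => x i / D i) ≠ 0 := by
    intro hzero
    apply hx
    rw [← hxy]
    funext i
    rw [show x i / D i = 0 from congrFun hzero i, mul_zero]
    rfl
  simpa only [hxy] using h _ hy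

/-- A certified lower bound `λ |y|² ≤ q y` with `λ > 0` gives `q y > 0` for `y ≠ 0` (the shape
of a Gershgorin-after-congruence verdict `λ_min ≥ λ > 0`). [folklore] -/
theorem quadForm_pos_of_lowerBound_pos {q : (ι → ℝ) → ℝ} {lam : ℝ} (hlam : 0 < lam)
    (h : ∀ y : ι → ℝ, lam * (y ⬝ᵥ y) ≤ q y) (y : ι → ℝ) (hy : y ≠ 0) : 0 < q y := by
  have hyy : 0 < y ⬝ᵥ y := by
    have hnn : 0 ≤ y ⬝ᵥ y := by
      unfold dotProduct; exact Finset.sum_nonneg fun i _ => mul_self_nonneg _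
    have hne : y ⬝ᵥ y ≠ 0 := fun h0 => hy (dotProduct_self_eq_zero.mp h0)
    exact lt_of_le_of_ne hnn (Ne.symm hne)
  exact lt_of_lt_of_le (mul_pos hlam hyy) (h y)

end Matrices

section Assembly
variable {E : Type*} [AddCommGroup E] [Module ℝ E]
variable {ι : Type*} [Fintype ι]

/-- **The approximate-Gram certificate.** `β` symmetric positive semidefinite on a real vector
space `E`; `u : ι → E` (exact solutions, data), `ũ : ι → E` (approximations) with total error
energy `Σᵢ β(uᵢ − ũᵢ, uᵢ − ũᵢ) ≤ d`; `S` symmetric with `vᵀ S v ≤ s|v|²`, `0 ≤ s`, `s d < 1`;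
`Ĝ i j = β(uⱼ, ũᵢ) + β(uᵢ − ũᵢ, ũⱼ)` the computable second-order Gram matrix. If
`0 < xᵀ Ĝ x − (Ĝx)ᵀ S (Ĝx) − d/(1 − s d) |S Ĝ x|²` for every `x ≠ 0`, then
`Ψ(z)ᵀ S Ψ(z) ≤ β(z, z)` for every `z ∈ E`, `Ψ(z)ᵢ = β(uᵢ, z)`. [folklore] -/
theorem dotProduct_mulVec_le_form_of_apprGram_certificate (β : LinearMap.BilinForm ℝ E)
    (hsymm : ∀ x y, β x y = β y x) (hpos : ∀ x, 0 ≤ β x x) (u ut : ι → E)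
    (S : Matrix ι ι ℝ) (hS : Sᵀ = S) {s d : ℝ} (hs : 0 ≤ s)
    (hSle : ∀ v, v ⬝ᵥ (S *ᵥ v) ≤ s * (v ⬝ᵥ v))
    (hd : ∑ i, β (u i - ut i) (u i - ut i) ≤ d) (hsd : s * d < 1)
    (Gh : Matrix ι ι ℝ) (hGh : ∀ i j, Gh i j = β (u j) (ut i) + β (u i - ut i) (ut j))
    (hcert : ∀ x : ι → ℝ, x ≠ 0 →
      0 < x ⬝ᵥ (Gh *ᵥ x) - (Gh *ᵥ x) ⬝ᵥ (S *ᵥ (Gh *ᵥ x))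
        - d / (1 - s * d) * ((S *ᵥ (Gh *ᵥ x)) ⬝ᵥ (S *ᵥ (Gh *ᵥ x))))
    (z : E) :
    (fun i => β (u i) z) ⬝ᵥ (S *ᵥ fun i => β (u i) z) ≤ β z z := by
  set G : Matrix ι ι ℝ := Matrix.of fun i j => β (u i) (u j) with hGdef
  set Er : Matrix ι ι ℝ := Matrix.of fun i j => β (u i - ut i) (u j - ut j) with hErdef
  have hG : ∀ i j, G i j = β (u i) (u j) := fun i j => rfl
  have hEr : ∀ i j, Er i j = β (u i - ut i) (u j - ut j) := fun i j => rfl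
  have hsplit : G = Gh + Er := gram_eq_apprGram_add_errGram β hsymm u ut G Gh Er hG hGh hEr
  have hErT : Erᵀ = Er := by
    ext i j
    rw [Matrix.transpose_apply, hEr, hEr, hsymm]
  have hEpos : ∀ x, 0 ≤ x ⬝ᵥ (Er *ᵥ x) :=
    gram_dotProduct_mulVec_nonneg β hpos (fun i => u i - ut i) Er hEr
  have htr : 0 ≤ ∑ i, β (u i - ut i) (u i - ut i) :=
    Finset.sum_nonneg fun i _ => hpos _
  have hd0 : 0 ≤ d := htr.trans hd
  have hEd : ∀ x, x ⬝ᵥ (Er *ᵥ x) ≤ d * (x ⬝ᵥ x) := by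
    intro x
    have hxx : 0 ≤ x ⬝ᵥ x := by
      unfold dotProduct; exact Finset.sum_nonneg fun i _ => mul_self_nonneg _
    exact (gram_dotProduct_mulVec_le_trace_mul β hsymm hpos (fun i => u i - ut i) Er hEr x).trans
      (mul_le_mul_of_nonneg_right hd hxx)
  refine dotProduct_mulVec_le_form_of_gram_certificate β hsymm hpos u G hG S ?_ z
  intro x hx
  have hpert := apprGram_perturbation Gh S Er hS hErT hs hd0 hsd hEpos hEd hSle x
  have h := hcert x hx
  rw [hsplit]
  linarith

end Assembly

end ApproximateGramCertificate
end Summit.NavierStokesRegularity.OSWSelfSimilar
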